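import Summits.CriticalPhenomena.PercolationContinuityZ3.Theorems.SahiMasterFamilyTerminalPrelim

/-!
# Face-vanishing triples at a common pivotal coordinate: the "needs / dominates" relations

Unit `prim-masterthm-p4` (gen 11; crux anchor stmt-CriticalPhenomena-4575, helper work; memo
`run/shared/lean/prim/prim-masterthm/prim-masterthm-p4/FACE-QUOTIENT-3.md` §5).  First structural bricks for the open tightness statement
`PositiveSomewhere.FaceVanishingCommonPivotalTight` (to which (P3+) `SahiE3PositiveSomewhere` is reduced in `…PositiveSomewhereAssembly`).
Let `x` be pivotal for all three increasing events `U_j` and let the minors of `U` lie in the zero-flag class `Z_3`.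

* `exists_not_affects_of_suppZeroFlag_three` — a `Z_3` triple of increasing events has, for EVERY coordinate `x`, a member on which `x` does
  not act (a zero flag has two members with disjoint supports);
* hence, at a common pivotal coordinate `x`, for every other coordinate `y`: the deletion minor `U^{y←0}` has a member `U_j^{y←0}` free of `x`
  ("`x` NEEDS `y` in `U_j`": every `x`-pivotal configuration of `U_j` contains `y`) and the contraction minor `U^{y←1}` has a member free of `x`
  ("`y` DOMINATES `x` in `U_j`") — `exists_needs_of_face`, `exists_dominates_of_face` (the `p_x³`-coefficient argument of the memo, done
  combinatorially);
* **`affects_secAt_false_of_dominates`** (Lemma D): if `y ≠ x` dominates `x` in `Z` and `x` is pivotal for `Z`, then `y` acts on the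
  `x`-DELETION `Z^{x←0}`;  **`affects_secAt_true_of_needs`** (Lemma N): if `x` needs `y` in `Z`, then `y` acts on the `x`-CONTRACTION `Z^{x←1}`;
* `exists_affects_deletion_of_face` / `exists_affects_contraction_of_face` — so at a common pivotal coordinate of a face-vanishing triple every
  other coordinate acts on some member's `x`-deletion AND on some member's `x`-contraction.
HONEST FRAMING: structural lemmas only; the tightness statement, (P3+), Sahi `C_k` / Kahn's Conjecture 5 remain OPEN. [this work]
-/

noncomputable section

open scoped Classical

namespace Summit.CriticalPhenomena.PercolationContinuityZ3.Theorems

namespace PositiveSomewhere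

open Finset Function
open Literature.Probability.Percolation (DeterminedBy)
open Literature.Probability.LatticeModels.Kahn2022 (Affects)

variable {ι : Type*} [Fintype ι]

/-- A zero-flag triple of increasing events has, for every coordinate, a member on which that coordinate does not act. [this work] -/
theorem exists_not_affects_of_suppZeroFlag_three {V : Fin 3 → Set (Set ι)} (hV : ∀ j, IsUpperSet (V j)) (hZ : SuppZeroFlag 3 V)
    (x : ι) : ∃ j, ¬ Affects (V j) x := by
  obtain ⟨a, b, -, hd⟩ := exists_disjoint_of_suppZeroFlag_three hV hZ
  by_cases ha : Affects (V a) x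
  · exact ⟨b, fun hb => Finset.disjoint_left.1 hd (mem_esupp.2 ha) (mem_esupp.2 hb)⟩
  · exact ⟨a, ha⟩

/-- **"`x` needs `y`" from the deletion minor**: if the `y`-deletions of three increasing events form a zero flag, then for every
coordinate `x` some member's `y`-deletion is not acted on by `x`. [this work] -/
theorem exists_needs_of_face {U : Fin 3 → Set (Set ι)} (hU : ∀ j, IsUpperSet (U j)) {y : ι}
    (hfv : SuppZeroFlag 3 (fun j => secAt y false (U j))) (x : ι) : ∃ j, ¬ Affects (secAt y false (U j)) x :=
  exists_not_affects_of_suppZeroFlag_three (fun j => isUpperSet_secAt y false (hU j)) hfv x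

/-- **"`y` dominates `x`" from the contraction minor**: if the `y`-contractions of three increasing events form a zero flag, then for every
coordinate `x` some member's `y`-contraction is not acted on by `x`. [this work] -/
theorem exists_dominates_of_face {U : Fin 3 → Set (Set ι)} (hU : ∀ j, IsUpperSet (U j)) {y : ι}
    (hfv : SuppZeroFlag 3 (fun j => secAt y true (U j))) (x : ι) : ∃ j, ¬ Affects (secAt y true (U j)) x :=
  exists_not_affects_of_suppZeroFlag_three (fun j => isUpperSet_secAt y true (hU j)) hfv x

omit [Fintype ι] in
/-- **Lemma D.**  Let `Z` be increasing with `x` pivotal, and `y ≠ x`.  If `x` does not act on the contraction `Z^{y←1}` ("`y` dominates `x`":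
`ω ∪ {x,y} ∈ Z ⇒ ω ∪ {y} ∈ Z`), then `y` acts on the deletion `Z^{x←0}`.  (Otherwise every `ω ∌ x` with `ω ∪ {x} ∈ Z` would satisfy
`ω ∪ {y} ∈ Z`, then `ω ∈ Z` since `Z^{x←0}` ignores `y` — so `x` would not be pivotal.) [this work] -/
theorem affects_secAt_false_of_dominates {Z : Set (Set ι)} (hZ : IsUpperSet Z) {x y : ι} (hxy : x ≠ y)
    (hx : ∃ ω, x ∉ ω ∧ ω ∉ Z ∧ insert x ω ∈ Z) (hdom : ¬ Affects (secAt y true Z) x) :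
    Affects (secAt x false Z) y := by
  by_contra hno
  obtain ⟨ω, hxω, hω, hωx⟩ := hx
  -- `ω ∈ Z^{y←1}`: since `insert x ω ∈ Z^{y←1}` and `x` does not act there
  have h1 : insert x ω ∈ secAt y true Z := by
    rw [mem_secAt]
    simp only [forceAt, cond_true]
    exact hZ (Set.subset_insert y _) hωx
  have h2 : ω ∈ secAt y true Z := by
    by_contra h
    exact hdom ⟨ω, h, h1⟩
  -- i.e. `insert y ω ∈ Z`, hence `insert y ω ∈ Z^{x←0}` (it does not contain `x`)
  have h3 : insert y ω ∈ Z := by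
    rw [mem_secAt] at h2
    simpa only [forceAt, cond_true] using h2
  have hxω' : x ∉ insert y ω := by
    rintro (h | h)
    · exact hxy h
    · exact hxω h
  have h4 : insert y ω ∈ secAt x false Z := (mem_secAt_false_iff_of_notMem hxω').2 h3
  -- `y` does not act on `Z^{x←0}`: so `ω ∈ Z^{x←0}`, i.e. `ω ∈ Z`
  have h5 : ω ∈ secAt x false Z := by
    by_contra h
    exact hno ⟨ω, h, h4⟩
  exact hω ((mem_secAt_false_iff_of_notMem hxω).1 h5)

omit [Fintype ι] in
/-- **Lemma N.**  Let `Z` be increasing with `x` pivotal, and `y ≠ x`.  If `x` does not act on the deletion `Z^{y←0}` ("`x` needs `y`":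
every `x`-pivotal configuration of `Z` contains `y`), then `y` acts on the contraction `Z^{x←1}`. [this work] -/
theorem affects_secAt_true_of_needs {Z : Set (Set ι)} (hZ : IsUpperSet Z) {x y : ι} (hxy : x ≠ y)
    (hx : ∃ ω, x ∉ ω ∧ ω ∉ Z ∧ insert x ω ∈ Z) (hneed : ¬ Affects (secAt y false Z) x) :
    Affects (secAt x true Z) y := by
  obtain ⟨ω, hxω, hω, hωx⟩ := hx
  -- the pivotal configuration contains `y`: otherwise it lives in the deletion `Z^{y←0}`, where `x` does not act
  have hyω : y ∈ ω := by
    by_contra hy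
    have h1 : insert x ω ∈ secAt y false Z := by
      have hy' : y ∉ insert x ω := by
        rintro (h | h)
        · exact hxy h.symm
        · exact hy h
      exact (mem_secAt_false_iff_of_notMem hy').2 hωx
    have h2 : ω ∈ secAt y false Z := by
      by_contra h
      exact hneed ⟨ω, h, h1⟩
    exact hω ((mem_secAt_false_iff_of_notMem hy).1 h2)
  -- `ω ∖ {y} ∉ Z^{x←1}` but `(ω ∖ {y}) ∪ {y} = ω ∈ Z^{x←1}`
  refine ⟨ω \ {y}, ?_, ?_⟩
  · intro h
    rw [mem_secAt] at h
    simp only [forceAt, cond_true] at h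
    -- `insert x (ω \ {y}) ∈ Z` and avoids `y`: it lies in `Z^{y←0}` where `x` does not act, so `ω \ {y} ∈ Z ⊆` contradiction with `ω ∉ Z`
    have hy' : y ∉ insert x (ω \ {y}) := by
      rintro (h' | h')
      · exact (hxω (h' ▸ hyω)).elim
      · exact h'.2 rfl
    have h1 : insert x (ω \ {y}) ∈ secAt y false Z := (mem_secAt_false_iff_of_notMem hy').2 h
    have h2 : ω \ {y} ∈ secAt y false Z := by
      by_contra h'
      exact hneed ⟨ω \ {y}, h', h1⟩
    have h3 : ω \ {y} ∈ Z := (mem_secAt_false_iff_of_notMem (fun h' => h'.2 rfl)).1 h2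
    exact hω (hZ (fun _ h => h.1) h3)
  · rw [Set.insert_sdiff_singleton, Set.insert_eq_of_mem hyω, mem_secAt]
    simpa only [forceAt, cond_true] using hωx

/-- **At a common pivotal coordinate of a face-vanishing triple, every other coordinate acts on some member's `x`-deletion.** [this work] -/
theorem exists_affects_deletion_of_face {U : Fin 3 → Set (Set ι)} (hU : ∀ j, IsUpperSet (U j)) {x y : ι} (hxy : x ≠ y)
    (hx : ∀ j, ∃ ω, x ∉ ω ∧ ω ∉ U j ∧ insert x ω ∈ U j) (hfv : SuppZeroFlag 3 (fun j => secAt y true (U j))) :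
    ∃ j, Affects (secAt x false (U j)) y := by
  obtain ⟨j, hj⟩ := exists_dominates_of_face hU hfv x
  exact ⟨j, affects_secAt_false_of_dominates (hU j) hxy (hx j) hj⟩

/-- **At a common pivotal coordinate of a face-vanishing triple, every other coordinate acts on some member's `x`-contraction.** [this work] -/
theorem exists_affects_contraction_of_face {U : Fin 3 → Set (Set ι)} (hU : ∀ j, IsUpperSet (U j)) {x y : ι} (hxy : x ≠ y)
    (hx : ∀ j, ∃ ω, x ∉ ω ∧ ω ∉ U j ∧ insert x ω ∈ U j) (hfv : SuppZeroFlag 3 (fun j => secAt y false (U j))) :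
    ∃ j, Affects (secAt x true (U j)) y := by
  obtain ⟨j, hj⟩ := exists_needs_of_face hU hfv x
  exact ⟨j, affects_secAt_true_of_needs (hU j) hxy (hx j) hj⟩

end PositiveSomewhere

end Summit.CriticalPhenomena.PercolationContinuityZ3.Theorems
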